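import Mathlib
import HarnessLib
import Literature.Analysis.FluidPDE.Tao2016AveragedNS.TaylorChainCertificate
import Summits.NavierStokesRegularity.NavierStokesRegularity.Theorems.TaylorModelRungThreeReadoutPackage
import Summits.NavierStokesRegularity.NavierStokesRegularity.Theorems.TaylorModelRungThreeReadoutG2Sigma

/-!
# Line `taylor-model` on crux K1b-DR (stmt-NavierStokesRegularity-23954) — stub G2 `stub_crossing`, helper 2:
# the crossing time `tauSel` in the last sub-step, the (E1) enclosures, and the flow-hypothesis-free core

Continuation of `…ReadoutG2Sigma`.  For a VALID certificate `cd` and a CHAIN-ENCLOSED flow selector `φ`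
(`ChainEnclosure cd φ`, stub G1's conclusion) and a polytope point `q` of stage `j ≤ N₀` (namespace `…G2`):

* `sigma_deriv_ge_gamma` (= first lemma L4.3): on the last sub-step the derivative `σf (Qb (φ, φ))` of the
  section value is `≥ γ j > 0` (transversality clause on the in-step enclosure `TP (S-1) u + Ball(Sp)`, (C3));
  `strictMonoOn_sigma`; node signs `sigma_node_start_lt` / `lt_sigma_node_end` ((C2) + the two sign clauses);
* **`tauSel_spec`** (= L2.3 / critic P-TM5, EXPORTED to G3/G4): `tauSel cd φ j q` is the least element of the
  crossing set, `Tn (S-1) < tauSel ≤ Tn S`, `σf (φ(q, tauSel)) = lev`, `< lev` before, `> lev` after;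
  `eq_tauSel_of_sigma_eq` (uniqueness of the crossing in the last sub-step);
* `inBall_stAt_tauSel` (the crossing state in `TP (S-1) (τ − Tn (S-1)) + Ball(Sp)`, `SpI` for the base centre),
  `inBall_SpO_of_chain` (= L2.4, the trivial κ-restart `z := φ(q,t)`, `u := 0` in (C4)), `window_M_bound`
  (the certificate's window `M`-clause along `[0, Tn S]`);
* `crossingReadouts_core : cd.Valid → ChainEnclosure cd φ → Crossing cd φ (tauSel cd φ) ∧ KBlockE1 cd φ (tauSel cd φ)`
  — the whole content of stub G2 with NO flow hypothesis (neither `IsFlowPackage` nor `IsWindowFlow` is needed: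
  everything used about `φ` is in `ChainEnclosure`), so the by-name stub file is one line against either interface.

MODEL-lattice bookkeeping only (rung TL-M3 of the NS ladder); nothing here is a statement about the
Navier–Stokes equations, and K1b-DR is not proved here.
-/

noncomputable section

-- the sub-problem namespace repeats the summit name by design (D-0017)
set_option linter.dupNamespace false

namespace Summit.NavierStokesRegularity.NavierStokesRegularity.Theorems.TaylorModelReadout.G2

open Set Literature.Analysis.FluidPDE.TaoCascade Literature.Analysis.FluidPDE.TaoCascade.TaylorChain

variable {cd : CertData}

/-! ### The crossing in the last sub-step -/

/-- **Transversality along the flow**: on the last sub-step the derivative of the section value along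
the trajectory of a polytope point is `≥ γ j`. [folklore] -/
theorem sigma_deriv_ge_gamma {φ : Flow} (hV : cd.Valid) (hC : ChainEnclosure cd φ) {j : ℕ}
    (hj : j ≤ cd.N₀) {q : Fin 4 → ℤ → ℝ} (hq : InPoly cd j q) {t : ℝ} (h1 : cd.Tn j (cd.S j - 1) ≤ t)
    (h2 : t ≤ cd.Tn j (cd.S j)) : cd.γ j ≤ cd.σf j (cd.Qb (stAt φ j q t) (stAt φ j q t)) := by
  have hS := valid_one_le_S hV hj
  have hTl := Tn_last hV.2.2.1 hj
  have hu : t - cd.Tn j (cd.S j - 1) ∈ Icc 0 (cd.h j (cd.S j - 1)) := ⟨by linarith, by linarith⟩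
  have hC3 := ((hC j hj q hq).2.2.1 (cd.S j - 1) (by omega) _ hu).1
  rw [add_sub_cancel] at hC3
  have h := valid_transversal hV hj _ hu _ hC3
  rwa [add_sub_cancel] at h

/-- **Strict monotonicity** of the section value on the last sub-step. [folklore] -/
theorem strictMonoOn_sigma {φ : Flow} (hV : cd.Valid) (hC : ChainEnclosure cd φ) {j : ℕ} (hj : j ≤ cd.N₀)
    {q : Fin 4 → ℤ → ℝ} (hq : InPoly cd j q) :
    StrictMonoOn (fun s => cd.σf j (stAt φ j q s)) (Icc (cd.Tn j (cd.S j - 1)) (cd.Tn j (cd.S j))) := by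
  have hω := valid_omega_pos hV hj
  have hN := valid_sigma_bound hV hj
  have hsol := (hC j hj q hq).1
  have h0 : 0 ≤ cd.Tn j (cd.S j - 1) := Tn_nonneg hV.2.2.1 hj (Nat.sub_le _ _)
  refine strictMonoOn_of_deriv_pos (convex_Icc _ _)
    ((continuousOn_sigma hω hN hsol).mono (Icc_subset_Icc_left h0)) ?_
  intro x hx
  rw [interior_Icc] at hx
  have hd := hasDerivWithinAt_sigma hω hN hsol (t := x) ⟨h0.trans hx.1.le, hx.2.le⟩
  rw [(hd.hasDerivAt (Icc_mem_nhds (h0.trans_lt hx.1) hx.2)).deriv]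
  exact (valid_gamma_pos hV hj).trans_le (sigma_deriv_ge_gamma hV hC hj hq hx.1.le hx.2.le)

/-- At node `S-1` the section value is below the level (node invariant + certificate clause). [folklore] -/
theorem sigma_node_start_lt {φ : Flow} (hV : cd.Valid) (hC : ChainEnclosure cd φ) {j : ℕ} (hj : j ≤ cd.N₀)
    {q : Fin 4 → ℤ → ℝ} (hq : InPoly cd j q) :
    cd.σf j (stAt φ j q (cd.Tn j (cd.S j - 1))) < cd.lev j := by
  obtain ⟨ξ, e, hξe, he, -⟩ := (hC j hj q hq).2.1 (cd.S j - 1) (Nat.sub_le _ _)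
  have hwin := sigma_eq_of_window (valid_omega_pos hV hj) (valid_sigma_bound hV hj)
    (y := stAt φ j q (cd.Tn j (cd.S j - 1))) (y' := cd.x j (cd.S j - 1) + cd.Cm j (cd.S j - 1) ξ + e)
    fun i k hk1 hk2 => (hξe i k hk1 hk2).2
  rw [hwin]
  exact valid_sigma_start hV hj ξ e (fun i k hk1 hk2 => (hξe i k hk1 hk2).1) he

/-- At node `S` the section value is above the level. [folklore] -/
theorem lt_sigma_node_end {φ : Flow} (hV : cd.Valid) (hC : ChainEnclosure cd φ) {j : ℕ} (hj : j ≤ cd.N₀)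
    {q : Fin 4 → ℤ → ℝ} (hq : InPoly cd j q) :
    cd.lev j < cd.σf j (stAt φ j q (cd.Tn j (cd.S j))) := by
  obtain ⟨ξ, e, hξe, he, -⟩ := (hC j hj q hq).2.1 (cd.S j) le_rfl
  have hwin := sigma_eq_of_window (valid_omega_pos hV hj) (valid_sigma_bound hV hj)
    (y := stAt φ j q (cd.Tn j (cd.S j))) (y' := cd.x j (cd.S j) + cd.Cm j (cd.S j) ξ + e)
    fun i k hk1 hk2 => (hξe i k hk1 hk2).2
  rw [hwin]
  exact valid_sigma_end hV hj ξ e (fun i k hk1 hk2 => (hξe i k hk1 hk2).1) he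

/-- **The crossing time `tauSel` (exported to G3/G4).** For a valid certificate, a chain-enclosed flow
and a polytope point `q` of stage `j`: `tauSel cd φ j q` is the LEAST element of the crossing set
`{t | Tn (S-1) ≤ t ≤ Tn S, lev ≤ σf (φ(q,t))}` (nonempty, closed: the infimum is attained),
`Tn (S-1) < tauSel ≤ Tn S`, the section value equals `lev` exactly there, is `< lev` on `[Tn (S-1), tauSel)`
and `> lev` on `(tauSel, Tn S]`. [folklore] -/
theorem tauSel_spec {φ : Flow} (hV : cd.Valid) (hC : ChainEnclosure cd φ) {j : ℕ} (hj : j ≤ cd.N₀)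
    {q : Fin 4 → ℤ → ℝ} (hq : InPoly cd j q) :
    IsLeast {t : ℝ | cd.Tn j (cd.S j - 1) ≤ t ∧ t ≤ cd.Tn j (cd.S j) ∧ cd.lev j ≤ cd.σf j (stAt φ j q t)}
        (tauSel cd φ j q) ∧
      cd.Tn j (cd.S j - 1) < tauSel cd φ j q ∧ tauSel cd φ j q ≤ cd.Tn j (cd.S j) ∧
      cd.σf j (stAt φ j q (tauSel cd φ j q)) = cd.lev j ∧
      (∀ t, cd.Tn j (cd.S j - 1) ≤ t → t < tauSel cd φ j q → cd.σf j (stAt φ j q t) < cd.lev j) ∧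
      (∀ t, tauSel cd φ j q < t → t ≤ cd.Tn j (cd.S j) → cd.lev j < cd.σf j (stAt φ j q t)) := by
  have hab : cd.Tn j (cd.S j - 1) ≤ cd.Tn j (cd.S j) := Tn_mono hV.2.2.1 hj (Nat.sub_le _ _) le_rfl
  have hcont : ContinuousOn (fun s => cd.σf j (stAt φ j q s))
      (Icc (cd.Tn j (cd.S j - 1)) (cd.Tn j (cd.S j))) :=
    (continuousOn_sigma (valid_omega_pos hV hj) (valid_sigma_bound hV hj) (hC j hj q hq).1).mono
      (Icc_subset_Icc_left (Tn_nonneg hV.2.2.1 hj (Nat.sub_le _ _)))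
  obtain ⟨τ, hL, h1, h2, h3, h4, h5⟩ := exists_isLeast_crossing hab hcont
    (strictMonoOn_sigma hV hC hj hq) (sigma_node_start_lt hV hC hj hq) (lt_sigma_node_end hV hC hj hq)
  have hτ : tauSel cd φ j q = τ := by
    unfold tauSel
    exact hL.csInf_eq
  rw [hτ]
  exact ⟨hL, h1, h2, h3, h4, h5⟩

/-- **Uniqueness of the crossing (exported to G3/G4)**: a time of the last sub-step at which the section
value equals the level IS `tauSel`. [folklore] -/
theorem eq_tauSel_of_sigma_eq {φ : Flow} (hV : cd.Valid) (hC : ChainEnclosure cd φ) {j : ℕ}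
    (hj : j ≤ cd.N₀) {q : Fin 4 → ℤ → ℝ} (hq : InPoly cd j q) {t : ℝ} (h1 : cd.Tn j (cd.S j - 1) ≤ t)
    (h2 : t ≤ cd.Tn j (cd.S j)) (ht : cd.σf j (stAt φ j q t) = cd.lev j) : t = tauSel cd φ j q := by
  obtain ⟨-, hτ1, hτ2, hτ3, -, -⟩ := tauSel_spec hV hC hj hq
  exact (strictMonoOn_sigma hV hC hj hq).injOn ⟨h1, h2⟩ ⟨hτ1.le, hτ2⟩ (ht.trans hτ3.symm)

/-- The crossing state sits in the last sub-step's in-step enclosure: E-level spread `Sp` for a polytope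
point, `SpI` for the base centre `x j 0`. [folklore] -/
theorem inBall_stAt_tauSel {φ : Flow} (hV : cd.Valid) (hC : ChainEnclosure cd φ) {j : ℕ} (hj : j ≤ cd.N₀)
    {q : Fin 4 → ℤ → ℝ} (hq : InPoly cd j q) :
    cd.InBall j (stAt φ j q (tauSel cd φ j q) -
        cd.TP j (cd.S j - 1) (tauSel cd φ j q - cd.Tn j (cd.S j - 1))) (cd.Sp j (cd.S j - 1)) ∧
      (q = cd.x j 0 → cd.InBall j (stAt φ j q (tauSel cd φ j q) -
        cd.TP j (cd.S j - 1) (tauSel cd φ j q - cd.Tn j (cd.S j - 1))) (cd.SpI j (cd.S j - 1))) := by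
  obtain ⟨-, h1, h2, -, -, -⟩ := tauSel_spec hV hC hj hq
  have hS := valid_one_le_S hV hj
  have hTl := Tn_last hV.2.2.1 hj
  have hu : tauSel cd φ j q - cd.Tn j (cd.S j - 1) ∈ Icc 0 (cd.h j (cd.S j - 1)) :=
    ⟨by linarith, by linarith⟩
  have h := (hC j hj q hq).2.2.1 (cd.S j - 1) (by omega) _ hu
  rwa [add_sub_cancel] at h

/-- **The trivial κ-restart (first lemma L2.4)**: at any time `t` of sub-step `s'` the entry trajectory itself
is a κ-restart with zero entry deviation, so the chain enclosure's (C4) puts `φ(q,t)` in the `SpO`-level in-step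
enclosure `TP s' (t − Tn s') + Ball(SpO s')` — the level at which the certificate states its window `M`-bounds
(never assume `Sp ≤ SpO`).  Also returns the restart's ODE clause (initial values). [folklore] -/
theorem inBall_SpO_of_chain {φ : Flow} (hV : cd.Valid) (hC : ChainEnclosure cd φ) {j : ℕ} (hj : j ≤ cd.N₀)
    {q : Fin 4 → ℤ → ℝ} (hq : InPoly cd j q) {s' : ℕ} (hs' : s' < cd.S j) {t : ℝ} (h1 : cd.Tn j s' ≤ t)
    (h2 : t ≤ cd.Tn j (s' + 1)) :
    cd.InBall j (stAt φ j q t - cd.TP j s' (t - cd.Tn j s')) (cd.SpO j s') ∧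
      SolvesOn cd φ j (stAt φ j q t) (cd.Tn j (cd.S j) - t) := by
  have hκ := valid_kappa_pos hV hj
  have hω := valid_omega_pos hV hj
  have hz : cd.InBall j (stAt φ j q t - stAt φ j q t) (cd.κ j) := by
    intro i k _ _
    rw [sub_self, Pi.zero_apply, Pi.zero_apply, abs_zero]
    exact (mul_pos hκ (hω k)).le
  have hC4 := (hC j hj q hq).2.2.2 s' hs' t h1 h2 (stAt φ j q t) hz
  have hin := (hC4.2.1 0 le_rfl (by rw [add_zero]; exact h2)).2
  rw [add_zero] at hin
  refine ⟨fun i k hk1 hk2 => ?_, hC4.1⟩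
  have h := hin i k hk1 hk2
  have h0 : stAt φ j (stAt φ j q t) 0 i k = φ j q i k t := (hC4.1 i k hk1 hk2).1
  rw [Pi.sub_apply, Pi.sub_apply, h0] at h
  exact h

/-- **Window `M`-bounds along the trajectory** of a polytope point on the whole stage horizon `[0, Tn j S]`:
locate the sub-step containing `t`, put `φ(q,t)` in its `SpO` in-step enclosure by the trivial restart, and
apply the certificate's window `M`-clause. [folklore] -/
theorem window_M_bound {φ : Flow} (hV : cd.Valid) (hC : ChainEnclosure cd φ) {j : ℕ} (hj : j ≤ cd.N₀)
    {q : Fin 4 → ℤ → ℝ} (hq : InPoly cd j q) {t : ℝ} (ht0 : 0 ≤ t) (ht1 : t ≤ cd.Tn j (cd.S j)) :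
    ∀ i k, -cd.Kb ≤ k → k ≤ cd.Ka →
      |φ j q i k t| ≤ cd.M k - cd.Λ j * cd.δ j * cd.τs * cd.ω j k - cd.mm := by
  obtain ⟨s', hs', h1, h2⟩ := exists_substep hV.2.2.1 hj ht0 ht1
  have hin := (inBall_SpO_of_chain hV hC hj hq hs' h1 h2).1
  have hstep := valid_Tn_succ hV hj hs'
  have hu : t - cd.Tn j s' ∈ Icc 0 (cd.h j s') := ⟨by linarith, by linarith⟩
  have hM := valid_M_clause hV hj hs' (t - cd.Tn j s') hu _ hin
  rw [add_sub_cancel] at hM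
  exact hM

/-- **Stub G2, flow-hypothesis-free core.** For a valid certificate and a chain-enclosed flow selector the
crossing-time selector `tauSel cd φ` satisfies the internal crossing facts `Crossing` and K1b-DR's (E1)
read-out block `KBlockE1`.  Neither `IsFlowPackage` (v4) nor `IsWindowFlow` (v4.1) is needed — everything used
about `φ` is in `ChainEnclosure` — so `stub_crossing : CrossingReadouts` is this theorem under either interface.
(E1): `0 ≤ Tn (S-1) < τ ≤ Tn S ≤ τs`; front amplitude `as` and behind-landing = the certificate's read-out
clause at the crossing state `TP (S-1) (τ − Tn (S-1)) + w'`, `w' ∈ Ball(Sp)`; `φ(q,0) = q` on the window = the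
ODE clause (C1); window `M`-bounds on `[0, τ]` = `window_M_bound`. [folklore] -/
theorem crossingReadouts_core {φ : Flow} (hV : cd.Valid) (hC : ChainEnclosure cd φ) :
    Crossing cd φ (tauSel cd φ) ∧ KBlockE1 cd φ (tauSel cd φ) := by
  refine ⟨?_, ?_⟩
  · intro j hj q hq
    obtain ⟨-, h1, h2, h3, h4, -⟩ := tauSel_spec hV hC hj hq
    exact ⟨h1, h2, h3, h4, (inBall_stAt_tauSel hV hC hj hq).1,
      (inBall_stAt_tauSel hV hC hj (valid_inPoly_x0 hV hj)).2 rfl⟩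
  · intro j hj q hq
    obtain ⟨-, h1, h2, h3, -, -⟩ := tauSel_spec hV hC hj hq
    have hTl := Tn_last hV.2.2.1 hj
    have h0 : 0 ≤ cd.Tn j (cd.S j - 1) := Tn_nonneg hV.2.2.1 hj (Nat.sub_le _ _)
    have hu : tauSel cd φ j q - cd.Tn j (cd.S j - 1) ∈ Icc 0 (cd.h j (cd.S j - 1)) :=
      ⟨by linarith, by linarith⟩
    have hE := valid_readE1 hV hj _ hu _ (inBall_stAt_tauSel hV hC hj hq).1
      (by rw [add_sub_cancel]; exact h3)
    rw [add_sub_cancel] at hE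
    obtain ⟨has, hbehind, -⟩ := hE
    refine ⟨h0.trans_lt h1, h2.trans (valid_Tn_le hV hj), has, fun i k hk1 hk2 => ⟨?_, ?_⟩, hbehind⟩
    · exact ((hC j hj q hq).1 i k hk1 hk2).1
    · intro t ht
      exact window_M_bound hV hC hj hq ht.1 (ht.2.trans h2) i k hk1 hk2

end Summit.NavierStokesRegularity.NavierStokesRegularity.Theorems.TaylorModelReadout.G2

end
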